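import Summits.QuantumFields.YangMills.Theorems.BalabanUVNodesN11RegionIndicatorResidual
import Summits.QuantumFields.YangMills.Theorems.BalabanUVNodesN21StepWeightsPositivity

/-!
# DAG node N11 — THE `quad` SLOT AT THE TOP PAIR, READ THROUGH THE DOOR: with print's law «`⟨A, 𝒬A⟩ = 0` at `A = 0`» the top pair's new side carries NO Gaussian factor and
# the (O3′) clause is [I] Thm 1's first-step identity `𝐓ρ₀ = exp A_1∘U_1` on the small fields (content in the TERMS); WITHOUT it — and the record carries no row on `quad` — a
# SWITCH (the residual's region map) and a DIAL (`quad_0(𝕋)` read at the new field) make OLD SIDE = NEW SIDE IDENTICALLY, for any prescribed terms, next to every `θ`, inside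
# K1⁹'s hypothesis class (count-neutral, LOCATED; no pin of record is touched)

HEADER — WORK-UNIT METADATA.  Cell `pub-ymgap`, YM-PLAN Track A (HUMAN RULING D-0062), seat `pub-ymgap-dag-n11-d` (g34; N11 [B14], s2), route `BalabanUVNodes`, item K1⁹ =
stmt-QuantumFields-27364 (helper lane, `--kind proof --supports 27364 --as helper`, count-neutral).  [III] = [Balaban1988Convergent], [B7] = [Balaban1985Averaging], [I] =
[Balaban1987RG1].  Over this seat's `…N11TopPairAtNewFieldShape` (g33: at a parameter whose step-1 residual factor has the NEW-FIELD shape the top pair's new side is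
`g ∅ V′ · e^{−½quad_0(𝕋)(base₁V′)} · exp A_1(s′)(U_1 V′)` — `sect2Slot_top_pair_eq_of_newFieldShape` — and (O3′) is its restriction to the small fields, `top_O3_iff_small_of_cutoff`),
`…N11RegionIndicatorResidual` (g33: the region-indicator residual passes `zhLocal` ∕ `zhLaws` ∕ `ZhUnity` next to every `θ`), dag-n21-c's `…N21StepWeightsPositivity.zetaOfRecord_nonneg`,
K0's `slotsTOfRecord_nonneg` ∕ `wOfRecord_nonneg`, node00-def-T's RECORD 13 v1.7 `H` (`Stage13HParams.Zh`, `WtOfRecord₁₃H`, `Provisos₁₃CoPH` ∕ `Provisos₁₃SepCoPH`, `TLaw₁₃CoPH`,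
`tLaw₁₃CoPH_iff`), 12a's `TkResidualW` = {`ζ0`, `quad`} (`Node00/TkWeightsOfRecord` §3: «`quad j Λ′` = `⟨A_j, 𝒬_j(Λ′) A_j⟩` of (2.21)∕(3.23) ([I]'s operators, not constructed in the
tree)»; rows: `Laws` = `ζ0 ≥ 0`, `LocalLaws` = two-scale locality OF `ζ0`; guard `ZhUnity` = `Σ_Y ζ0 = 1` — NONE READS `quad`), 11a's `TkWeights.w = chiA · exp(−½quad)` and
`baseCfg_snd` (the base configuration has ZERO fluctuation variables at every scale, `rfl`).

WHY THIS FILE.  g33 opened «the door, generic in the pin»: through 12b's two-scale row the first 𝐓-law's top-pair clause at a new-field-shaped residual is its restriction to the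
(3.2)-small coarse fields, with right-hand side `e^{−½quad_0(𝕋)(base₁V′)} · exp A_1(s′; u₁, (∅,0), e₁)(U_1(V′))` — [III] Thm 1's main-term SHAPE.  This file reads the one
slot of that right-hand side the residual rows do not constrain: `quad`.  In print `quad_0(𝕋)` is the value of [I]'s fluctuation form `⟨A_0, 𝒬_0(𝕋) A_0⟩` — a quadratic form
in the scale-`0` FLUCTUATION variables `A_0 = (ω 0).2`, which are ZERO at 11a's base configuration `base₁(V′)` (`baseCfg_snd`; print: at `Ω_1 = Λ_1 = 𝕋` there are no
fluctuation variables left to integrate).  §1: under that law (DISPLAYED as `hqA : (ω j).2 = 0 → quad_j(Λ′)(ω) = 0`, hence `hq0 : quad_0(𝕋)(base₁V′) = 0`) the Gaussian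
factor is `1`, the new side is `g ∅ V′ · exp A_1(s′)(U_1 V′)`, and the door reads: (O3′) at the top pair ⟺ `slotT ≡ 0` OR `𝐓ρ₀(𝕋,𝕋)(V′) = exp A_1(s′; u₁, (∅,0), e₁)(U_1(V′))`
for a.e. small `V′` of the support — [I] Thm 1 (0.22)–(0.25) at the first step VERBATIM IN SHAPE, whose content lives in the term values `(u₁, e₁)` under `Sect2.LawsT`.  §2–§4:
the record carries NO such law (`TkResidualW.Laws` ∕ `.LocalLaws` ∕ `ZhUnity` read `ζ0` only), and without it the top-pair clause is served BY FIAT — take the region-indicator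
residual (g33) with the SWITCH `R_p V′ = ∅ ↔ 0 < 𝐓ρ₀(𝕋,𝕋)(V′)` and the DIAL `quad_0(𝕋)(ω) := 2·A_1(s′; u_p, (∅,0), e_p)(U_1((ω 1).1)) − 2·log 𝐓ρ₀(𝕋,𝕋)((ω 1).1)`: then
`g ∅ V′ · e^{−½quad} · e^{A_1} = 𝟙{0 < 𝐓ρ₀}·𝐓ρ₀·e^{−A_1}·e^{A_1} = 𝐓ρ₀(𝕋,𝕋)(V′)` at EVERY coarse field (§2, `exp(log x − a)·exp a = x`), the re-pin is inhabited next to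
every `θ` with the rows `zhLocal` ∕ `zhLaws` ∕ `ZhUnity` transferred (§3; the companion `…TopPairQuadSlotK1Hypotheses` transfers ALL FOUR of K1⁹'s hypothesis-side conjuncts —
`Provisos₁₃SepCoPH`, `ZhUnity`, `SlotsNondegenerate₁₃`, `Admissible`).  So what the first 𝐓-law asks of a K1⁹ witness AT THE TOP PAIR is decided
by the PIN of `quad` (node-00 object C2, [I]'s `⟨A, 𝒬A⟩`; or the one-line law `hqA` on `TkResidualW`), not by K1⁹'s displayed provisos: with the law it is [I] Thm 1's identity,
without it nothing.  A LOCATED reading for the type owners (node00-def-T ∕ K0b ∕ RR-2), in the kernel; nothing of Bałaban is asserted.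

WHAT THIS FILE PROVES (0 `def`, 0 `sorry`, standard axioms).  §1 `quad_baseCfg_eq_zero_of_zeroAtZeroFluct` (`hqA ⇒ hq0`) · ★ `sect2Slot_top_pair_eq_of_quadZeroAtBase` (new side
`= g ∅ V′ · exp A_1(U_1 V′)`, no Gaussian factor) · ★★ `top_O3_iff_expAction_on_small_of_quadZeroAtBase` ((O3′)-top ⟺ `slotT ≡ 0 ∨` a.e. on the small support `𝐓ρ₀(𝕋,𝕋) =
exp A_1(s′)(U_1 ·)`).  §2 ★★★ `slotsT_top_pair_eq_sect2Slot_of_switch_dial` (switch + dial at `V′`, `0 ≤ 𝐓ρ₀(V′)` ⇒ old side `=` new side AT `V′`, any terms) ·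
`slotsTOfRecord_nonneg_of_provisos₁₃CoPH` (`0 ≤ 𝐓ρ₀` from the rows `zetaUnity` ∕ `zetaAbs`) · ★★★ `top_O3_clause_of_switch_dial` (hence the (O3′) conjunct of the top pair, for
the prescribed terms).  §3 `seq_top_unique` (the top history of length `1` is unique) · ★ `zhLocal_of_topRepin` · ★ `zhLaws_of_topRepin` · ★ `zhUnity_of_topRepin` (rows and guard transfer) · ★★★★ `exists_zh_top_pair_identity_by_fiat`
(HEADLINE: next to every `θ`, for any prescribed term assignment `u_p` and constants `e_p`, a parameter with the same `Stage13RParams` data ∕ `Phih`, the same residual off the top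
histories, the rows transferred, at which `𝐓ρ₀(𝕋,𝕋)(V′) = sect2Slot(W^{θ′}(s′), s′, u_p, e_p, U_1)(V′)` at EVERY `V′` with `0 ≤ 𝐓ρ₀(𝕋,𝕋)(V′)`, every run).

HONEST FRAMING.  A READING on the tree's own rows and objects (count-neutral, LOCATED): nothing of Bałaban asserted or refuted — the fiat of §2–§4 exploits exactly the ABSENCE
of print's law «`⟨A_j, 𝒬_j A_j⟩` is a form in `A_j`» on the un-pinned slot `quad` (the tree's own words: «[I]'s operators, not constructed in the tree»), and §1 shows what that law
restores; the dial is NOT print's form and the region map of the switch is NOT print's (3.2) region; [I] Thm 1's identity is DISPLAYED as one side of an `↔`, never claimed;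
K1⁹'s `∃θ` NOT advanced and NOT refuted (the other histories of the first 𝐓-law, its term laws `Sect2.LawsT`, and every later law are untouched); no `Stage13HParams` of record
is constructed or modified (§3 is an anonymous-constructor inhabitation next to an arbitrary `θ`); N11 NOT discharged; K1⁹ NOT closed; no registered stub touched; counts unmoved
(typed 28∕28 · discharged 8∕27).  REPAIR CENSUS (owners node00-def-T ∕ K0b ∕ RR-2, not this seat): (q1) the one-line law `hqA` as a row of `TkResidualW.Laws` (met by `quad ≡ 0`
— 12a's `laws_one`, dag-n11-d g9's `rePinH` — and by any Gaussian `quad` in `(ω j).2`); (q2) the pin of `quad` to [I]'s form (object C2) — the road of record; (q3) neither —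
then the top-pair conjunct of the first 𝐓-law carries no content at the record and no reader should book it as such.  One finite four-torus programme at fixed `ε = L^{−K}`; NOT
ℝ⁴, NOT OS, NOT a mass gap, NOT Clay.  No `sorry`, `axiom`, `def`, `instance`, `notation`.  Sources (SHAPE only): [III] Thm 1 p.262, remark p.262, (2.18) p.257, (2.21)–(2.23)
p.258, p.267, (3.1)–(3.5) pp.264–265, (3.16)–(3.20) pp.268–269, (3.23)–(3.25) p.270; [B7] Prop. 2 (52)–(54) p.26; [I] Thm 1 p.259, (0.22)–(0.25) pp.256–257, (1.15)–(1.16) p.262.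
-/

noncomputable section

open MeasureTheory
open scoped BigOperators Matrix.Norms.L2Operator

namespace Summit.QuantumFields.YangMills.Theorems.BalabanUVNodesN11TopPairQuadSlot

open Literature.MathematicalPhysics.QuantumFieldTheory.Balaban1983to89 T4Continuum Node00 Node00.Tk B14.Eq218Concrete B14.Sect3Decomp
open Literature.MathematicalPhysics.QuantumFieldTheory.Balaban1983to89.ExpMeanLog (deltaSU)
open B14.Eq213MaximalDomains (side)
open BalabanUVNodesN11TopPairAtNewFieldShape (sect2Slot_top_pair_eq_of_newFieldShape top_O3_iff_small_of_cutoff)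
open BalabanUVNodesN11TopPairLocalResidual (WtOfRecord₁₃H_ζ_eq_ζ0)
open N21StepWeightsPositivity (zetaOfRecord_nonneg)

variable {F : T4Family} {N : ℕ} [NeZero N]

/-! ## §1. With print's law «`quad` vanishes at zero fluctuation field» the top pair's new side has NO Gaussian factor -/

section HonestQuad

variable (θ : Stage13HParams F N) (p : B12.RunParams)

/-- **PRINT's LAW AT THE BASE CONFIGURATION**: a form `quad_j(Λ′)(ω)` that vanishes whenever the scale-`j` fluctuation variables `(ω j).2` vanish (displayed: `⟨A_j, 𝒬_j(Λ′) A_j⟩`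
is a quadratic form in `A_j`) vanishes at 11a's base configuration `base₁(V′)`, whose fluctuation variables are `0` at every scale (`baseCfg_snd`).
[cite: Balaban1988Convergent, (2.21) p.258, (3.23) p.270; Balaban1987RG1, (1.15)–(1.16) p.262 (shape only)] -/
theorem quad_baseCfg_eq_zero_of_zeroAtZeroFluct {n : ℕ} (s : SeqOfRecord F θ.ν θ.τ9.M (gOfRecord₁₃ F N θ.toStage13Params p) p.K n) {j : ℕ}
    {Λ' : Set (Site (F.P p.K) 0)} (hqA : ∀ ω, (ω j).2 = 0 → (θ.Zh p n s.Ω s.Λ).quad j Λ' ω = 0) {k : ℕ} (Vk : GaugeField (F.P p.K) k (SU N)) :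
    (θ.Zh p n s.Ω s.Λ).quad j Λ' (baseCfg (V := FluctV N) k Vk) = 0 :=
  hqA _ (baseCfg_snd (V := FluctV N) k j Vk)

/-- ★ **UNDER THAT LAW THE NEW SIDE OF THE TOP PAIR IS `g ∅ V′ · exp A_1(s′; u₁, (∅,0), e₁)(U_1(V′))`** — the door's new side (`…TopPairAtNewFieldShape.sect2Slot_top_pair_eq_of_newFieldShape`)
with the factor `e^{−½quad_0(𝕋)(base₁V′)}` EQUAL TO `1`: no Gaussian prefactor survives at a top pair, exactly as in print (there are no fluctuation variables to integrate at
`Ω_1 = Λ_1 = 𝕋`). [cite: Balaban1988Convergent, (2.18) p.257, (2.21)–(2.23) p.258, (3.23)–(3.25) p.270, p.267; Balaban1987RG1, Thm 1 p.259] -/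
theorem sect2Slot_top_pair_eq_of_quadZeroAtBase (s' : SeqOfRecord F θ.ν θ.τ9.M (gOfRecord₁₃ F N θ.toStage13Params p) p.K 1)
    {g : Set (Site (F.P p.K) 0) → GaugeField (F.P p.K) 1 (SU N) → ℝ} (hζ : ∀ Y ω, (θ.Zh p 1 s'.Ω s'.Λ).ζ0 0 Y ω = g Y (ω 1).1) (hΩ : s'.Ω 1 = Set.univ) (hΛ : s'.Λ 1 = Set.univ)
    (hq0 : ∀ V' : GaugeField (F.P p.K) 1 (SU N), (θ.Zh p 1 s'.Ω s'.Λ).quad 0 Set.univ (baseCfg (V := FluctV N) 1 V') = 0)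
    (Sg : Sect2.Setting (MatA N) (SU N)) (Rz : Sect2.Residual (F.P p.K) (MatA N)) (u₁ : Sect2.TermValues (F.P p.K) (MatA N) (FluctV N) θ.τ9.M) (e₁ : ℝ) (U : BgMap F N p.K)
    (V' : GaugeField (F.P p.K) 1 (SU N)) :
    sect2Slot F N (FluctV N) p.K Sg Rz (WtOfRecord₁₃H F N θ p s') s' u₁ e₁ U V' =
      g ∅ V' * Real.exp ((sect2ActionDataOfRecord F N (FluctV N) p.K Sg Rz s' u₁ (fun _ => ∅, fun _ => 0) e₁).action23 1 (U (fun j => ((baseCfg (V := FluctV N) 1 V') j).1))) := by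
  rw [sect2Slot_top_pair_eq_of_newFieldShape θ p s' hζ hΩ hΛ Sg Rz u₁ e₁ U V', hq0 V', mul_zero, Real.exp_zero, mul_one]

/-- ★★ **THE DOOR UNDER PRINT's LAW — (O3′) AT THE TOP PAIR ⟺ `slotT ≡ 0` OR `𝐓ρ₀(𝕋,𝕋)(V′) = exp A_1(s′; u₁, (∅,0), e₁)(U_1(V′))` FOR a.e. SMALL `V′` OF THE SUPPORT** (Stage-13 record,
`1 ≤ M`, `0 < M₂`, `0 < K`, the `α₀` guards, `ε₁η₁² + 8δ₀ ≤ α₀η₁²`; profile cut off on the rough fields (`hcut`) and `= 1` on the small ones (`hone`); `hq0`): [I] Thm 1's first-step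
identity `𝐓ρ₀ = χ · exp(−A_eff)` with NO prefactor — the content is carried entirely by the term values `(u₁, e₁)` (under `Sect2.LawsT` in `TLaw₁₃CoPH`), DISPLAYED as the right-hand
side, never claimed. [cite: Balaban1988Convergent, Thm 1 p.262, (3.1)–(3.5) pp.264–265, (3.25) p.270, p.267; Balaban1985Averaging, Prop. 2 (52)–(54) p.26; Balaban1987RG1, Thm 1 p.259, (0.22)–(0.25) pp.256–257] -/
theorem top_O3_iff_expAction_on_small_of_quadZeroAtBase (hM : 1 ≤ θ.τ9.M) (hM₂ : 0 < θ.ν.M₂) (hK : 0 < p.K) {α₀ : ℝ} (hα : 0 < α₀)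
    (hα3 : (143 * (((((F.P p.K).d + 4 : ℕ) : ℝ)) ^ 2 / 4) ^ 2) * α₀ ≤ 1 / 3)
    (hα2 : 2 * α₀ ≤ 2 * deltaSU (Fin N) / ((((F.P p.K).d + 4) * (F.P p.K).L : ℕ) : ℝ) ^ 2)
    (hαε : epsOfRecord θ.ν (gOfRecord₁₃ F N θ.toStage13Params p) 1 * (F.P p.K).eta 1 ^ 2 + 4 * (2 * deltaOfRecord θ.ν (gOfRecord₁₃ F N θ.toStage13Params p) 0 θ.A₁) ≤
      α₀ * (F.P p.K).eta 1 ^ 2)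
    (s' : SeqOfRecord F θ.ν θ.τ9.M (gOfRecord₁₃ F N θ.toStage13Params p) p.K 1)
    {g : Set (Site (F.P p.K) 0) → GaugeField (F.P p.K) 1 (SU N) → ℝ} (hζ : ∀ Y ω, (θ.Zh p 1 s'.Ω s'.Λ).ζ0 0 Y ω = g Y (ω 1).1) (hΩ : s'.Ω 1 = Set.univ) (hΛ : s'.Λ 1 = Set.univ)
    (hcut : ∀ V', ¬ PlaqSmall (2 * α₀ * (((F.P p.K).L : ℝ) ^ 1 * (F.P p.K).eta 1) ^ 2) V' → g ∅ V' = 0)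
    (hone : ∀ V', PlaqSmall (2 * α₀ * (((F.P p.K).L : ℝ) ^ 1 * (F.P p.K).eta 1) ^ 2) V' → g ∅ V' = 1)
    (hq0 : ∀ V' : GaugeField (F.P p.K) 1 (SU N), (θ.Zh p 1 s'.Ω s'.Λ).quad 0 Set.univ (baseCfg (V := FluctV N) 1 V') = 0)
    (u₁ : Sect2.TermValues (F.P p.K) (MatA N) (FluctV N) θ.τ9.M) (e₁ : ℝ) :
    (slotsTOfRecord F N θ.ν θ.τ9 (EOfRecord₁₃ F N θ.toStage13Params) (wOfRecord₉ F N θ.toStage9Params) θ.ppSel p (gOfRecord₁₃ F N θ.toStage13Params p) 1 s' = 0 ∨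
      ∀ᵐ V' ∂fieldMeasure (F.P p.K) 1 (SU N),
        chiSeqOfRecord F N θ.ν θ.τ9.M (gOfRecord₁₃ F N θ.toStage13Params p) p.K 1 s' V' ≠ 0 →
          slotsTOfRecord F N θ.ν θ.τ9 (EOfRecord₁₃ F N θ.toStage13Params) (wOfRecord₉ F N θ.toStage9Params) θ.ppSel p (gOfRecord₁₃ F N θ.toStage13Params p) 1 s' V' =
            sect2Slot F N (FluctV N) p.K (settingOfRecord₁₃ F N θ.toStage13Params p) (θ.rzAt p s') (WtOfRecord₁₃H F N θ p s') s' u₁ e₁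
              (UbgOfRecord₁₃CoP F N θ.toStage13Params p 1 s') V') ↔
    (slotsTOfRecord F N θ.ν θ.τ9 (EOfRecord₁₃ F N θ.toStage13Params) (wOfRecord₉ F N θ.toStage9Params) θ.ppSel p (gOfRecord₁₃ F N θ.toStage13Params p) 1 s' = 0 ∨
      ∀ᵐ V' ∂fieldMeasure (F.P p.K) 1 (SU N),
        chiSeqOfRecord F N θ.ν θ.τ9.M (gOfRecord₁₃ F N θ.toStage13Params p) p.K 1 s' V' ≠ 0 →
          PlaqSmall (2 * α₀ * (((F.P p.K).L : ℝ) ^ 1 * (F.P p.K).eta 1) ^ 2) V' →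
            slotsTOfRecord F N θ.ν θ.τ9 (EOfRecord₁₃ F N θ.toStage13Params) (wOfRecord₉ F N θ.toStage9Params) θ.ppSel p (gOfRecord₁₃ F N θ.toStage13Params p) 1 s' V' =
              Real.exp ((sect2ActionDataOfRecord F N (FluctV N) p.K (settingOfRecord₁₃ F N θ.toStage13Params p) (θ.rzAt p s') s' u₁ (fun _ => ∅, fun _ => 0) e₁).action23 1
                (UbgOfRecord₁₃CoP F N θ.toStage13Params p 1 s' (fun j => ((baseCfg (V := FluctV N) 1 V') j).1)))) := by
  rw [top_O3_iff_small_of_cutoff θ p hM hM₂ hK hα hα3 hα2 hαε s' hζ hΩ hΛ hcut u₁ e₁]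
  refine or_congr_right (Filter.eventually_congr (Filter.Eventually.of_forall fun V' => ?_))
  refine imp_congr_right fun _ => imp_congr_right fun hs => ?_
  rw [sect2Slot_top_pair_eq_of_quadZeroAtBase θ p s' hζ hΩ hΛ hq0 _ _ u₁ e₁ _ V', hone V' hs, one_mul]

end HonestQuad

/-! ## §2. Without the law: a SWITCH (the profile) and a DIAL (`quad_0(𝕋)` read at the new field) make old side = new side IDENTICALLY -/

section Dial

variable (θ : Stage13HParams F N) (p : B12.RunParams)

/-- ★★★ **THE SWITCH-AND-DIAL IDENTITY** (top pair `s′ = (𝕋, 𝕋)`, ANY term values `(u₁, e₁)`, one coarse field `V′` with `0 ≤ 𝐓ρ₀(𝕋,𝕋)(V′)`): if the generation-`0` residual factor has the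
new-field shape with `g ∅ V′ = 𝟙{0 < 𝐓ρ₀(𝕋,𝕋)(V′)}` (SWITCH) and the form reads `quad_0(𝕋)(base₁V′) = 2·A_1(s′; u₁, (∅,0), e₁)(U_1(V′)) − 2·log 𝐓ρ₀(𝕋,𝕋)(V′)` wherever
`0 < 𝐓ρ₀(𝕋,𝕋)(V′)` (DIAL), then OLD SIDE = NEW SIDE AT `V′`: `𝐓ρ₀(𝕋,𝕋)(V′) = sect2Slot(W^θ(s′), s′, u₁, e₁, U_1)(V′)` — an algebraic identity (`exp(log x − a)·exp a = x`), nothing of Bałaban.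
[cite: Balaban1988Convergent, (2.18) p.257, (2.21)–(2.23) p.258, (3.23)–(3.25) p.270, p.267 (bookkeeping)] -/
theorem slotsT_top_pair_eq_sect2Slot_of_switch_dial (s' : SeqOfRecord F θ.ν θ.τ9.M (gOfRecord₁₃ F N θ.toStage13Params p) p.K 1) (hΩ : s'.Ω 1 = Set.univ)
    (hΛ : s'.Λ 1 = Set.univ) (u₁ : Sect2.TermValues (F.P p.K) (MatA N) (FluctV N) θ.τ9.M) (e₁ : ℝ)
    {g : Set (Site (F.P p.K) 0) → GaugeField (F.P p.K) 1 (SU N) → ℝ} (hζ : ∀ Y ω, (θ.Zh p 1 s'.Ω s'.Λ).ζ0 0 Y ω = g Y (ω 1).1) (V' : GaugeField (F.P p.K) 1 (SU N))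
    (hsw : g ∅ V' = if 0 < slotsTOfRecord F N θ.ν θ.τ9 (EOfRecord₁₃ F N θ.toStage13Params) (wOfRecord₉ F N θ.toStage9Params) θ.ppSel p
        (gOfRecord₁₃ F N θ.toStage13Params p) 1 s' V' then 1 else 0)
    (hdial : 0 < slotsTOfRecord F N θ.ν θ.τ9 (EOfRecord₁₃ F N θ.toStage13Params) (wOfRecord₉ F N θ.toStage9Params) θ.ppSel p (gOfRecord₁₃ F N θ.toStage13Params p) 1 s' V' →
      (θ.Zh p 1 s'.Ω s'.Λ).quad 0 Set.univ (baseCfg (V := FluctV N) 1 V') =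
        2 * (sect2ActionDataOfRecord F N (FluctV N) p.K (settingOfRecord₁₃ F N θ.toStage13Params p) (θ.rzAt p s') s' u₁ (fun _ => ∅, fun _ => 0) e₁).action23 1
              (UbgOfRecord₁₃CoP F N θ.toStage13Params p 1 s' (fun j => ((baseCfg (V := FluctV N) 1 V') j).1)) -
          2 * Real.log (slotsTOfRecord F N θ.ν θ.τ9 (EOfRecord₁₃ F N θ.toStage13Params) (wOfRecord₉ F N θ.toStage9Params) θ.ppSel p
            (gOfRecord₁₃ F N θ.toStage13Params p) 1 s' V'))
    (h0 : 0 ≤ slotsTOfRecord F N θ.ν θ.τ9 (EOfRecord₁₃ F N θ.toStage13Params) (wOfRecord₉ F N θ.toStage9Params) θ.ppSel p (gOfRecord₁₃ F N θ.toStage13Params p) 1 s' V') :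
    slotsTOfRecord F N θ.ν θ.τ9 (EOfRecord₁₃ F N θ.toStage13Params) (wOfRecord₉ F N θ.toStage9Params) θ.ppSel p (gOfRecord₁₃ F N θ.toStage13Params p) 1 s' V' =
      sect2Slot F N (FluctV N) p.K (settingOfRecord₁₃ F N θ.toStage13Params p) (θ.rzAt p s') (WtOfRecord₁₃H F N θ p s') s' u₁ e₁
        (UbgOfRecord₁₃CoP F N θ.toStage13Params p 1 s') V' := by
  rw [sect2Slot_top_pair_eq_of_newFieldShape θ p s' hζ hΩ hΛ _ _ u₁ e₁ _ V', hsw]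
  rcases h0.eq_or_lt with h | h
  · rw [← h, if_neg (lt_irrefl 0), zero_mul, zero_mul]
  · rw [if_pos h, hdial h, one_mul]
    set a := (sect2ActionDataOfRecord F N (FluctV N) p.K (settingOfRecord₁₃ F N θ.toStage13Params p) (θ.rzAt p s') s' u₁ (fun _ => ∅, fun _ => 0) e₁).action23 1
      (UbgOfRecord₁₃CoP F N θ.toStage13Params p 1 s' (fun j => ((baseCfg (V := FluctV N) 1 V') j).1)) with ha
    set x := slotsTOfRecord F N θ.ν θ.τ9 (EOfRecord₁₃ F N θ.toStage13Params) (wOfRecord₉ F N θ.toStage9Params) θ.ppSel p (gOfRecord₁₃ F N θ.toStage13Params p) 1 s' V'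
      with hx
    have h1 : -(1 / 2 : ℝ) * (2 * a - 2 * Real.log x) = Real.log x - a := by ring
    rw [h1, Real.exp_sub, Real.exp_log h, div_mul_cancel₀ _ (Real.exp_pos a).ne']

/-- **`0 ≤ 𝐓ρ₀(s′)(V′)` FROM THE PROVISO ROWS** `zetaUnity`, `zetaAbs` of `Provisos₁₃CoPH` (K0's `slotsTOfRecord_nonneg` at non-negative step weights, `wOfRecord_nonneg` ∘ dag-n21-c's
`zetaOfRecord_nonneg`). [cite: Balaban1988Convergent, (3.16) p.268, (3.24)–(3.25) p.270 (bookkeeping)] -/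
theorem slotsTOfRecord_nonneg_of_provisos₁₃CoPH (h : θ.Provisos₁₃CoPH F N) {n : ℕ} (s : SeqOfRecord F θ.ν θ.τ9.M (gOfRecord₁₃ F N θ.toStage13Params p) p.K n)
    (V : GaugeField (F.P p.K) n (SU N)) :
    0 ≤ slotsTOfRecord F N θ.ν θ.τ9 (EOfRecord₁₃ F N θ.toStage13Params) (wOfRecord₉ F N θ.toStage9Params) θ.ppSel p (gOfRecord₁₃ F N θ.toStage13Params p) n s V :=
  slotsTOfRecord_nonneg F N θ.ν θ.τ9 (EOfRecord₁₃ F N θ.toStage13Params)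
    (fun p' g' j s'' U V'' => wOfRecord_nonneg F N θ.ν θ.τ9.M p' g' j θ.A₁ (zetaOfRecord_nonneg F N θ.ν θ.τ9.M h.zetaUnity h.zetaAbs) s'' U V'') θ.ppSel p
    (gOfRecord₁₃ F N θ.toStage13Params p) n s V

/-- ★★★ **HENCE THE (O3′) CLAUSE OF THE TOP PAIR HOLDS — FOR THE PRESCRIBED TERMS, WITH NOTHING OF [I] ∕ [III]** at every `θ` with `Provisos₁₃CoPH` whose top-history residual carries the
switch and the dial at every coarse field: the identity holds at EVERY `V′`, a fortiori a.e. on the support. [cite: Balaban1988Convergent, Thm 1 p.262, (2.18) p.257, (3.25) p.270 (bookkeeping)] -/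
theorem top_O3_clause_of_switch_dial (h : θ.Provisos₁₃CoPH F N) (s' : SeqOfRecord F θ.ν θ.τ9.M (gOfRecord₁₃ F N θ.toStage13Params p) p.K 1) (hΩ : s'.Ω 1 = Set.univ)
    (hΛ : s'.Λ 1 = Set.univ) (u₁ : Sect2.TermValues (F.P p.K) (MatA N) (FluctV N) θ.τ9.M) (e₁ : ℝ)
    {g : Set (Site (F.P p.K) 0) → GaugeField (F.P p.K) 1 (SU N) → ℝ} (hζ : ∀ Y ω, (θ.Zh p 1 s'.Ω s'.Λ).ζ0 0 Y ω = g Y (ω 1).1)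
    (hsw : ∀ V', g ∅ V' = if 0 < slotsTOfRecord F N θ.ν θ.τ9 (EOfRecord₁₃ F N θ.toStage13Params) (wOfRecord₉ F N θ.toStage9Params) θ.ppSel p
        (gOfRecord₁₃ F N θ.toStage13Params p) 1 s' V' then 1 else 0)
    (hdial : ∀ V', 0 < slotsTOfRecord F N θ.ν θ.τ9 (EOfRecord₁₃ F N θ.toStage13Params) (wOfRecord₉ F N θ.toStage9Params) θ.ppSel p (gOfRecord₁₃ F N θ.toStage13Params p) 1 s' V' →
      (θ.Zh p 1 s'.Ω s'.Λ).quad 0 Set.univ (baseCfg (V := FluctV N) 1 V') =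
        2 * (sect2ActionDataOfRecord F N (FluctV N) p.K (settingOfRecord₁₃ F N θ.toStage13Params p) (θ.rzAt p s') s' u₁ (fun _ => ∅, fun _ => 0) e₁).action23 1
              (UbgOfRecord₁₃CoP F N θ.toStage13Params p 1 s' (fun j => ((baseCfg (V := FluctV N) 1 V') j).1)) -
          2 * Real.log (slotsTOfRecord F N θ.ν θ.τ9 (EOfRecord₁₃ F N θ.toStage13Params) (wOfRecord₉ F N θ.toStage9Params) θ.ppSel p
            (gOfRecord₁₃ F N θ.toStage13Params p) 1 s' V')) :
    slotsTOfRecord F N θ.ν θ.τ9 (EOfRecord₁₃ F N θ.toStage13Params) (wOfRecord₉ F N θ.toStage9Params) θ.ppSel p (gOfRecord₁₃ F N θ.toStage13Params p) 1 s' = 0 ∨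
      ∀ᵐ V' ∂fieldMeasure (F.P p.K) 1 (SU N),
        chiSeqOfRecord F N θ.ν θ.τ9.M (gOfRecord₁₃ F N θ.toStage13Params p) p.K 1 s' V' ≠ 0 →
          slotsTOfRecord F N θ.ν θ.τ9 (EOfRecord₁₃ F N θ.toStage13Params) (wOfRecord₉ F N θ.toStage9Params) θ.ppSel p (gOfRecord₁₃ F N θ.toStage13Params p) 1 s' V' =
            sect2Slot F N (FluctV N) p.K (settingOfRecord₁₃ F N θ.toStage13Params p) (θ.rzAt p s') (WtOfRecord₁₃H F N θ p s') s' u₁ e₁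
              (UbgOfRecord₁₃CoP F N θ.toStage13Params p 1 s') V' :=
  Or.inr (Filter.Eventually.of_forall fun V' _ =>
    slotsT_top_pair_eq_sect2Slot_of_switch_dial θ p s' hΩ hΛ u₁ e₁ hζ V' (hsw V') (hdial V') (slotsTOfRecord_nonneg_of_provisos₁₃CoPH θ p h s' V'))

end Dial

/-! ## §3. The switch and the dial are inhabited next to every `θ`, with the rows `zhLocal`, `zhLaws` and the guard `ZhUnity` transferred -/

section Inhabited

variable (θ : Stage13HParams F N)

omit [NeZero N] in
/-- **THE TOP HISTORY OF LENGTH `1` IS UNIQUE**: two (2.18) indices of length `1` with `Ω_1 = Λ_1 = 𝕋` coincide (off the window both are `∅`). [cite: Balaban1988Convergent, (2.1) p.254, (2.18) p.257] -/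
theorem seq_top_unique {ν : Stage7Numerics} {M : ℕ} {g : ℕ → ℝ} {K : ℕ} (s t : SeqOfRecord F ν M g K 1) (hsΩ : s.Ω 1 = Set.univ) (hsΛ : s.Λ 1 = Set.univ)
    (htΩ : t.Ω 1 = Set.univ) (htΛ : t.Λ 1 = Set.univ) : s = t := by
  refine Seq.ext' (funext fun j => ?_) (funext fun j => ?_)
  · by_cases hj : j = 1
    · subst hj; rw [hsΩ, htΩ]
    · have hw : ¬ (1 ≤ j ∧ j ≤ 1) := fun h => hj (le_antisymm h.2 h.1)
      rw [s.Ω_off j hw, t.Ω_off j hw]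
  · by_cases hj : j = 1
    · subst hj; rw [hsΛ, htΛ]
    · have hw : ¬ (1 ≤ j ∧ j ≤ 1) := fun h => hj (le_antisymm h.2 h.1)
      rw [s.Λ_off j hw, t.Λ_off j hw]

variable {θ} {θ' : Stage13HParams F N} {R : (p : B12.RunParams) → GaugeField (F.P p.K) 1 (SU N) → Set (Site (F.P p.K) 0)}

/-- ★ **THE ROW `zhLocal` TRANSFERS** across the re-pin (at the top histories the new generation-`0` factor reads `(ω 1).1` only; everything else is `θ`'s).
[cite: Balaban1988Convergent, (3.1) p.264, (3.2)–(3.4) p.265, p.267] -/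
theorem zhLocal_of_topRepin (hoff : ∀ p n Ω Λ, ¬ (n = 1 ∧ Ω 1 = Set.univ ∧ Λ 1 = Set.univ) → θ'.Zh p n Ω Λ = θ.Zh p n Ω Λ)
    (hS : ∀ p n Ω Λ j Y ω, (θ'.Zh p n Ω Λ).ζ0 (j + 1) Y ω = (θ.Zh p n Ω Λ).ζ0 (j + 1) Y ω)
    (h0 : ∀ p n Ω Λ, (n = 1 ∧ Ω 1 = Set.univ ∧ Λ 1 = Set.univ) → ∀ Y ω, (θ'.Zh p n Ω Λ).ζ0 0 Y ω = Set.indicator {R p (ω 1).1} (1 : Set (Site (F.P p.K) 0) → ℝ) Y)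
    (hloc : ∀ p n Ω Λ, (θ.Zh p n Ω Λ).LocalLaws) : ∀ p n Ω Λ, (θ'.Zh p n Ω Λ).LocalLaws := by
  intro p n Ω Λ
  by_cases htop : n = 1 ∧ Ω 1 = Set.univ ∧ Λ 1 = Set.univ
  · refine ⟨fun j Y ω ω' hj hj1 => ?_⟩
    rcases j with _ | j
    · rw [h0 p n Ω Λ htop, h0 p n Ω Λ htop, hj1]
    · rw [hS, hS]
      exact (hloc p n Ω Λ).zeta0_local (j + 1) Y ω ω' hj hj1
  · rw [hoff p n Ω Λ htop]
    exact hloc p n Ω Λ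

/-- ★ **THE ROW `zhLaws` TRANSFERS** (`ζ0 ≥ 0`). [cite: Balaban1988Convergent, p.267 (bookkeeping)] -/
theorem zhLaws_of_topRepin (hoff : ∀ p n Ω Λ, ¬ (n = 1 ∧ Ω 1 = Set.univ ∧ Λ 1 = Set.univ) → θ'.Zh p n Ω Λ = θ.Zh p n Ω Λ)
    (hS : ∀ p n Ω Λ j Y ω, (θ'.Zh p n Ω Λ).ζ0 (j + 1) Y ω = (θ.Zh p n Ω Λ).ζ0 (j + 1) Y ω)
    (h0 : ∀ p n Ω Λ, (n = 1 ∧ Ω 1 = Set.univ ∧ Λ 1 = Set.univ) → ∀ Y ω, (θ'.Zh p n Ω Λ).ζ0 0 Y ω = Set.indicator {R p (ω 1).1} (1 : Set (Site (F.P p.K) 0) → ℝ) Y)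
    (hlaws : ∀ p n Ω Λ, (θ.Zh p n Ω Λ).Laws) : ∀ p n Ω Λ, (θ'.Zh p n Ω Λ).Laws := by
  intro p n Ω Λ
  by_cases htop : n = 1 ∧ Ω 1 = Set.univ ∧ Λ 1 = Set.univ
  · refine ⟨fun j Y ω => ?_⟩
    rcases j with _ | j
    · rw [h0 p n Ω Λ htop]
      exact Set.indicator_nonneg (fun _ _ => zero_le_one) Y
    · rw [hS]
      exact (hlaws p n Ω Λ).zeta0_nonneg (j + 1) Y ω
  · rw [hoff p n Ω Λ htop]
    exact hlaws p n Ω Λ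

/-- ★ **THE GUARD `ZhUnity` TRANSFERS** (at the top histories exactly one region carries the generation-`0` weight). [cite: Balaban1988Convergent, (3.16)–(3.20) pp.268–269] -/
theorem zhUnity_of_topRepin (hoff : ∀ p n Ω Λ, ¬ (n = 1 ∧ Ω 1 = Set.univ ∧ Λ 1 = Set.univ) → θ'.Zh p n Ω Λ = θ.Zh p n Ω Λ)
    (hS : ∀ p n Ω Λ j Y ω, (θ'.Zh p n Ω Λ).ζ0 (j + 1) Y ω = (θ.Zh p n Ω Λ).ζ0 (j + 1) Y ω)
    (h0 : ∀ p n Ω Λ, (n = 1 ∧ Ω 1 = Set.univ ∧ Λ 1 = Set.univ) → ∀ Y ω, (θ'.Zh p n Ω Λ).ζ0 0 Y ω = Set.indicator {R p (ω 1).1} (1 : Set (Site (F.P p.K) 0) → ℝ) Y)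
    (hU : θ.ZhUnity) : θ'.ZhUnity := by
  intro p n Ω Λ j ω
  by_cases htop : n = 1 ∧ Ω 1 = Set.univ ∧ Λ 1 = Set.univ
  · rcases j with _ | j
    · simp_rw [h0 p n Ω Λ htop]
      rw [finsum_eq_single _ (R p (ω 1).1) fun Y hY => Set.indicator_of_notMem (by simpa using hY) _]
      rw [Set.indicator_of_mem (Set.mem_singleton _), Pi.one_apply]
    · simp_rw [hS]
      exact hU p n Ω Λ (j + 1) ω
  · simp_rw [hoff p n Ω Λ htop]
    exact hU p n Ω Λ j ω

/-- ★★★★ **HEADLINE — THE TOP-PAIR CLAUSE OF THE FIRST 𝐓-LAW IS SERVED BY THE FREE SLOT `quad` ALONE, NEXT TO EVERY `θ`, FOR ANY PRESCRIBED TERMS**: for every term assignment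
`u_p` (indexed by the run and the cube-size letter `M`) and vacuum constants `e_p` there is a parameter `θ′` with the SAME `Stage13RParams` data and `Phih` as `θ`, the SAME residual
`Zh` at every history other than the top ones of length `1`, satisfying `zhLocal` ∕ `zhLaws` ∕ `ZhUnity` whenever `θ` does, at which — for EVERY run `p`, the top history
`s′ = (𝕋, 𝕋)` and EVERY coarse field `V′` with `0 ≤ 𝐓ρ₀(𝕋,𝕋)(V′)` (automatic under the rows `zetaUnity`, `zetaAbs`, §2) — OLD SIDE = NEW SIDE:
`𝐓ρ₀(𝕋,𝕋)(V′) = sect2Slot(W^{θ′}(s′), s′, u_p, e_p, U_1)(V′)`.  The witness: ζ0 := the region indicator with `R_p V′ = ∅ ↔ 0 < 𝐓ρ₀(𝕋,𝕋)(V′)`, `quad_0 := 2·A_1(s′;u_p,e_p)(U_1 V_1) −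
2·log 𝐓ρ₀(𝕋,𝕋)(V_1)`.  So, absent a law tying `quad` to the fluctuation variables (§1's `hqA`; the record's rows on `TkResidualW` are `ζ0 ≥ 0`, two-scale locality of `ζ0`, `ZhUnity` —
none reads `quad`), the (O3′) clause of the top pair carries NO content at the record: it can be met without any of [I] Thm 1's analysis.  LOCATED, count-neutral; nothing of
Bałaban asserted or refuted; K1⁹'s `∃θ` neither advanced nor refuted (the other histories and the term laws are untouched). [cite: Balaban1988Convergent, Thm 1 p.262, (2.18) p.257, (2.21)–(2.23) p.258, (3.2) p.265, p.267, (3.23)–(3.25) p.270] -/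
theorem exists_zh_top_pair_identity_by_fiat (θ : Stage13HParams F N)
    (u : (p : B12.RunParams) → (M : ℕ) → Sect2.TermValues (F.P p.K) (MatA N) (FluctV N) M) (e : B12.RunParams → ℝ) :
    ∃ θ' : Stage13HParams F N, θ'.toStage13RParams = θ.toStage13RParams ∧ θ'.Phih = θ.Phih ∧
      (∀ p n Ω Λ, ¬ (n = 1 ∧ Ω 1 = Set.univ ∧ Λ 1 = Set.univ) → θ'.Zh p n Ω Λ = θ.Zh p n Ω Λ) ∧
      ((∀ p n Ω Λ, (θ.Zh p n Ω Λ).LocalLaws) → ∀ p n Ω Λ, (θ'.Zh p n Ω Λ).LocalLaws) ∧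
      ((∀ p n Ω Λ, (θ.Zh p n Ω Λ).Laws) → ∀ p n Ω Λ, (θ'.Zh p n Ω Λ).Laws) ∧
      (θ.ZhUnity → θ'.ZhUnity) ∧
      ∀ (p : B12.RunParams) (s' : SeqOfRecord F θ'.ν θ'.τ9.M (gOfRecord₁₃ F N θ'.toStage13Params p) p.K 1), s'.Ω 1 = Set.univ → s'.Λ 1 = Set.univ →
        ∀ V' : GaugeField (F.P p.K) 1 (SU N),
          0 ≤ slotsTOfRecord F N θ'.ν θ'.τ9 (EOfRecord₁₃ F N θ'.toStage13Params) (wOfRecord₉ F N θ'.toStage9Params) θ'.ppSel p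
              (gOfRecord₁₃ F N θ'.toStage13Params p) 1 s' V' →
          slotsTOfRecord F N θ'.ν θ'.τ9 (EOfRecord₁₃ F N θ'.toStage13Params) (wOfRecord₉ F N θ'.toStage9Params) θ'.ppSel p
              (gOfRecord₁₃ F N θ'.toStage13Params p) 1 s' V' =
            sect2Slot F N (FluctV N) p.K (settingOfRecord₁₃ F N θ'.toStage13Params p) (θ'.rzAt p s') (WtOfRecord₁₃H F N θ' p s') s' (u p θ'.τ9.M) (e p)
              (UbgOfRecord₁₃CoP F N θ'.toStage13Params p 1 s') V' := by
  classical
  -- the old side and the action term of the top history, as functions of the run, the history and the new field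
  let T : (p : B12.RunParams) → SeqOfRecord F θ.ν θ.τ9.M (gOfRecord₁₃ F N θ.toStage13Params p) p.K 1 → GaugeField (F.P p.K) 1 (SU N) → ℝ :=
    fun p s V' => slotsTOfRecord F N θ.ν θ.τ9 (EOfRecord₁₃ F N θ.toStage13Params) (wOfRecord₉ F N θ.toStage9Params) θ.ppSel p (gOfRecord₁₃ F N θ.toStage13Params p) 1 s V'
  let A : (p : B12.RunParams) → SeqOfRecord F θ.ν θ.τ9.M (gOfRecord₁₃ F N θ.toStage13Params p) p.K 1 → GaugeField (F.P p.K) 1 (SU N) → ℝ :=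
    fun p s V' => (sect2ActionDataOfRecord F N (FluctV N) p.K (settingOfRecord₁₃ F N θ.toStage13Params p) (θ.rzAt p s) s (u p θ.τ9.M) (fun _ => ∅, fun _ => 0)
      (e p)).action23 1 (UbgOfRecord₁₃CoP F N θ.toStage13Params p 1 s (fun j => ((baseCfg (V := FluctV N) 1 V') j).1))
  -- the SWITCH (region map) and the DIAL
  let R : (p : B12.RunParams) → GaugeField (F.P p.K) 1 (SU N) → Set (Site (F.P p.K) 0) :=
    fun p V' => if ∃ s : SeqOfRecord F θ.ν θ.τ9.M (gOfRecord₁₃ F N θ.toStage13Params p) p.K 1, s.Ω 1 = Set.univ ∧ s.Λ 1 = Set.univ ∧ 0 < T p s V' then ∅ else Set.univ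
  let D : (p : B12.RunParams) → GaugeField (F.P p.K) 1 (SU N) → ℝ :=
    fun p V' => if h : ∃ s : SeqOfRecord F θ.ν θ.τ9.M (gOfRecord₁₃ F N θ.toStage13Params p) p.K 1, s.Ω 1 = Set.univ ∧ s.Λ 1 = Set.univ then
      2 * A p h.choose V' - 2 * Real.log (T p h.choose V') else 0
  -- the re-pinned residual at the top histories of length `1` (generation `0`: the switch and the dial; generations `≥ 1`: `θ`'s), `θ`'s residual everywhere else
  let Ztop : (p : B12.RunParams) → ℕ → (ℕ → Set (Site (F.P p.K) 0)) → (ℕ → Set (Site (F.P p.K) 0)) → TkResidualW F N (FluctV N) p.K := fun p n Ω Λ =>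
    ⟨fun j Y ω => match j with
        | 0 => Set.indicator {R p (ω 1).1} (1 : Set (Site (F.P p.K) 0) → ℝ) Y
        | j + 1 => (θ.Zh p n Ω Λ).ζ0 (j + 1) Y ω,
      fun j Λ' ω => match j with
        | 0 => D p (ω 1).1
        | j + 1 => (θ.Zh p n Ω Λ).quad (j + 1) Λ' ω⟩
  let Zh' : (p : B12.RunParams) → ℕ → (ℕ → Set (Site (F.P p.K) 0)) → (ℕ → Set (Site (F.P p.K) 0)) → TkResidualW F N (FluctV N) p.K :=
    fun p n Ω Λ => if n = 1 ∧ Ω 1 = Set.univ ∧ Λ 1 = Set.univ then Ztop p n Ω Λ else θ.Zh p n Ω Λ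
  have hZoff : ∀ p n Ω Λ, ¬ (n = 1 ∧ Ω 1 = Set.univ ∧ Λ 1 = Set.univ) → Zh' p n Ω Λ = θ.Zh p n Ω Λ := fun p n Ω Λ hnot => if_neg hnot
  have hZtop : ∀ p n Ω Λ, (n = 1 ∧ Ω 1 = Set.univ ∧ Λ 1 = Set.univ) → Zh' p n Ω Λ = Ztop p n Ω Λ := fun p n Ω Λ htop => if_pos htop
  let θ' : Stage13HParams F N := { θ with Zh := Zh' }
  have hoff : ∀ p n Ω Λ, ¬ (n = 1 ∧ Ω 1 = Set.univ ∧ Λ 1 = Set.univ) → θ'.Zh p n Ω Λ = θ.Zh p n Ω Λ := hZoff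
  have hS : ∀ p n Ω Λ j Y ω, (θ'.Zh p n Ω Λ).ζ0 (j + 1) Y ω = (θ.Zh p n Ω Λ).ζ0 (j + 1) Y ω := fun p n Ω Λ j Y ω => by
    show (Zh' p n Ω Λ).ζ0 (j + 1) Y ω = _
    by_cases htop : n = 1 ∧ Ω 1 = Set.univ ∧ Λ 1 = Set.univ
    · rw [hZtop p n Ω Λ htop]
    · rw [hZoff p n Ω Λ htop]
  have h0 : ∀ p n Ω Λ, (n = 1 ∧ Ω 1 = Set.univ ∧ Λ 1 = Set.univ) →
      ∀ Y ω, (θ'.Zh p n Ω Λ).ζ0 0 Y ω = Set.indicator {R p (ω 1).1} (1 : Set (Site (F.P p.K) 0) → ℝ) Y := fun p n Ω Λ htop Y ω => by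
    show (Zh' p n Ω Λ).ζ0 0 Y ω = _
    rw [hZtop p n Ω Λ htop]
  have hq : ∀ p n Ω Λ, (n = 1 ∧ Ω 1 = Set.univ ∧ Λ 1 = Set.univ) → ∀ Λ' ω, (θ'.Zh p n Ω Λ).quad 0 Λ' ω = D p (ω 1).1 := fun p n Ω Λ htop Λ' ω => by
    show (Zh' p n Ω Λ).quad 0 Λ' ω = _
    rw [hZtop p n Ω Λ htop]
  refine ⟨θ', rfl, rfl, hoff, zhLocal_of_topRepin hoff hS h0, zhLaws_of_topRepin hoff hS h0, zhUnity_of_topRepin hoff hS h0, fun p s' hΩ hΛ V' hV' => ?_⟩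
  -- at the top history `s′` of the run `p`: the switch reads `𝟙{0 < T p s′ V′}`, the dial reads `2·A p s′ V′ − 2·log (T p s′ V′)`
  have hex : ∃ s : SeqOfRecord F θ.ν θ.τ9.M (gOfRecord₁₃ F N θ.toStage13Params p) p.K 1, s.Ω 1 = Set.univ ∧ s.Λ 1 = Set.univ := ⟨s', hΩ, hΛ⟩
  have hch : hex.choose = s' := seq_top_unique _ _ hex.choose_spec.1 hex.choose_spec.2 hΩ hΛ
  have hb : (fun j => ((baseCfg (V := FluctV N) 1 V') j).1) 1 = V' := funext fun b => baseCfg_fst_self (V := FluctV N) 1 V' b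
  have hsw : Set.indicator {R p V'} (1 : Set (Site (F.P p.K) 0) → ℝ) ∅ = if 0 < T p s' V' then 1 else 0 := by
    by_cases hpos : 0 < T p s' V'
    · have hR : R p V' = ∅ := if_pos ⟨s', hΩ, hΛ, hpos⟩
      rw [if_pos hpos, hR, Set.indicator_of_mem (Set.mem_singleton _), Pi.one_apply]
    · have hR : R p V' = Set.univ := by
        refine if_neg ?_
        rintro ⟨s, hsΩ, hsΛ, hs⟩
        rw [seq_top_unique s s' hsΩ hsΛ hΩ hΛ] at hs
        exact hpos hs
      rw [if_neg hpos, hR]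
      exact Set.indicator_of_notMem (fun h => Set.empty_ne_univ (Set.mem_singleton_iff.1 h)) _
  have hdial : 0 < T p s' V' → (θ'.Zh p 1 s'.Ω s'.Λ).quad 0 Set.univ (baseCfg (V := FluctV N) 1 V') = 2 * A p s' V' - 2 * Real.log (T p s' V') := fun _ => by
    rw [hq p 1 s'.Ω s'.Λ ⟨rfl, hΩ, hΛ⟩]
    show D p ((baseCfg (V := FluctV N) 1 V') 1).1 = _
    rw [show ((baseCfg (V := FluctV N) 1 V') 1).1 = V' from hb]
    show (if h : ∃ s : SeqOfRecord F θ.ν θ.τ9.M (gOfRecord₁₃ F N θ.toStage13Params p) p.K 1, s.Ω 1 = Set.univ ∧ s.Λ 1 = Set.univ then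
      2 * A p h.choose V' - 2 * Real.log (T p h.choose V') else 0) = _
    rw [dif_pos hex, hch]
  have hζ : ∀ Y ω, (θ'.Zh p 1 s'.Ω s'.Λ).ζ0 0 Y ω = (fun Y' (W : GaugeField (F.P p.K) 1 (SU N)) => Set.indicator {R p W} (1 : Set (Site (F.P p.K) 0) → ℝ) Y') Y (ω 1).1 :=
    h0 p 1 s'.Ω s'.Λ ⟨rfl, hΩ, hΛ⟩
  exact slotsT_top_pair_eq_sect2Slot_of_switch_dial θ' p s' hΩ hΛ (u p θ.τ9.M) (e p)
    (g := fun Y' (W : GaugeField (F.P p.K) 1 (SU N)) => Set.indicator {R p W} (1 : Set (Site (F.P p.K) 0) → ℝ) Y') hζ V' hsw hdial hV'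

end Inhabited


end Summit.QuantumFields.YangMills.Theorems.BalabanUVNodesN11TopPairQuadSlot

end
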